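import Summits.QuantumFields.BalabanUV.Beta.FP.TadpoleSmearBridge

/-!
# `BalabanUV.Beta.FP.BubbleSmearBridge` — road «FP», N7 H-route, row H2-ASM-1b: THE ONE-LOOP BUBBLE `ExpKernelCalculus.bubble A V₀ V₁` (nested `tr∘comp∘comp`
# tsums over a finite fibre) REWRITTEN AS A FINITE SUM OF FLAT DOUBLE SMEARS over `(ℤ⁴×ℤ⁴)×(ℤ⁴×ℤ⁴)` — the input shape of `FP/ExpLocalisedBubbleMixed`
# ([folklore] absolutely convergent rearrangement; nothing of the manuscripts)

HONEST DEPENDENCY (page 1, mandatory): continuum YM on T⁴ ⇐ BetaPertH ∧ nine spine estimates (0/9 proved); BetaPertH ⇐ (D1) ∧ (D4) ∧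
CAP+tail; G-an2-4 gates asym, D1 and NE2/3/4.  HONEST FRAMING (cell contract, verbatim): «discharging `BetaPertH` makes Bałaban's UV
stability UNCONDITIONAL — a real constructive-QFT result; it is NOT the continuum limit and NOT the Clay problem.»  THIS MODULE is elementary [folklore] real
analysis (Fubini for absolutely summable families on countable products, finite fibre sums); every analytic input (a BOUNDED leg kernel `A`, two BI-LOCALISED vertex
kernels) is a HYPOTHESIS displayed in the signatures; no `def`, no `Prop` fact, nothing cited, 0 sorry.  NOT the perfect bubble's VALUE, NOT `hgerm`, NOT D1, NOT BetaPertH,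
NOT continuum, NOT Clay.

ROW (road FP owner d1-p3-g6, `H2V-DESIGN.md` f78878bd5f8d2d18 §4; OFFER «H2-ASM-1b» journal l.24320): the consumer H2-ASM-3 starts from
`hessKer Pker V W μ ν z = ½·tadpole Pker (W μ 0 ν z) − ½·bubble Pker (V μ 0) (V ν z)` (`FP/PerfectPolarization`, p240631); this file delivers the bubble in the currency of
`FP/ExpLocalisedBubbleMixed.abs_bubble_sub_lead_le` (weights `c₀ p := V₀ p.1 p.2 g f`, `c₁ q := V₁ (z+q.2) (z+q.1) h a`, legs `F v := A 0 (−v) a g`, `G v := A 0 v f h`).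

CONTENT (`Pt = ℤ⁴`, finite fibre `Φ`; `A V₀ V₁ : MKer 4 Φ`; `|A x y a b| ≤ CA`, `BiLoc V₀ 0 0 C₀ δ`, `BiLoc V₁ z z C₁ δ`, `δ > 0`).
* §1 letters: `loc_vertex₀` (`|V₀ p.1 p.2 g f| ≤ C₀·e^{−δ|p.1|₁}e^{−δ|p.2|₁}`), `loc_vertex₁` (`|V₁ (z+q.2) (z+q.1) h a| ≤ C₁·e^{−δ|q.1|₁}e^{−δ|q.2|₁}`), `tsum_vertex_eq_zero_of_fibre`∕
  `tsum_vertex₁_eq_zero_of_fibre` (per-leg annihilation ⟹ zero total mass, both vertices; CONDITIONAL lemmas — for the vertices of record (a3) is TOTAL mass, E-FP-7-1,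
  and the identities of §3 need no mass hypothesis); `transl_apply` is imported from `FP/TadpoleSmearBridge` (v1 of this file restated it: p244001 bounced `dedup.landed`).
* §2 summabilities: `summable_leg₀`∕`summable_leg₁` (the `u`- and `w`-families of `comp A V₀`∕`comp A V₁`), `summable_flat` (the four-leg family).
* §3 **`bubble_eq_sum_tsum`**: `bubble A V₀ V₁ = Σ_{a f g h} Σ'_{P} V₀ P.1.1 P.1.2 g f · V₁ (z+P.2.2) (z+P.2.1) h a · A (z+P.2.1) P.1.1 a g · A P.1.2 (z+P.2.2) f h`;
  **`bubble_eq_sum_smear`** (translation-invariant `A`): the same with `A (z+P.2.1) P.1.1 a g = A 0 (−(z + P.2.1 − P.1.1)) a g`, `A P.1.2 (z+P.2.2) f h = A 0 (z + P.2.2 − P.1.2) f h`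
  — LITERALLY the `B z` of `FP/ExpLocalisedBubbleMixed`.
Unit `b2b-balaban-beta-d1-formalise-leaf-02` (gen 8).
-/

noncomputable section

namespace Summit.QuantumFields.BalabanUV.Beta.FP.BubbleSmearBridge

open Finset Filter Topology
open scoped BigOperators
open Literature.MathematicalPhysics.QuantumFieldTheory.Balaban1983to89
open Literature.MathematicalPhysics.QuantumFieldTheory.Balaban1983to89.Beta
open B12Sec2to5 (l1 l1_nonneg)
open ExpKernelCalculus (Site MKer Zl Zl_pos BiLoc comp tr bubble shiftK summable_exp_shift')
open Summit.QuantumFields.BalabanUV.Beta.FP.ExpLocalisedBubble (summable_weight summable_expWeight_pow nonneg_of_loc)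
open Summit.QuantumFields.BalabanUV.Beta.FP.TadpoleSmearBridge (transl_apply)
open DyadicShell (Pt)

variable {Φ : Type*} [Fintype Φ]

/-! ## §1 Letters of the vertices and of the leg -/

section Letters

variable {A V₀ V₁ : MKer 4 Φ} {CA C₀ C₁ δ : ℝ} {z : Pt}

omit [Fintype Φ] in
/-- [folklore] The vertex at the origin as a two-point weight in the engine's currency. -/
theorem loc_vertex₀ (hV₀ : BiLoc V₀ 0 0 C₀ δ) (g f : Φ) :
    ∀ p : Pt × Pt, |V₀ p.1 p.2 g f| ≤ C₀ * (Real.exp (-δ * l1 p.1) * Real.exp (-δ * l1 p.2)) := fun p => by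
  have h := hV₀ p.1 p.2 g f
  rw [sub_zero, sub_zero, show -δ * (l1 p.1 + l1 p.2) = -δ * l1 p.1 + -δ * l1 p.2 by ring, Real.exp_add] at h
  exact h

omit [Fintype Φ] in
/-- [folklore] The vertex at `z`, recentred, as a two-point weight in the engine's currency (legs listed as `(q.1, q.2) = (x′, w′)`: `V₁ (z+w′) (z+x′)`). -/
theorem loc_vertex₁ (hV₁ : BiLoc V₁ z z C₁ δ) (h a : Φ) :
    ∀ q : Pt × Pt, |V₁ (z + q.2) (z + q.1) h a| ≤ C₁ * (Real.exp (-δ * l1 q.1) * Real.exp (-δ * l1 q.2)) := fun q => by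
  have h1 := hV₁ (z + q.2) (z + q.1) h a
  rw [add_sub_cancel_left, add_sub_cancel_left, show -δ * (l1 q.2 + l1 q.1) = -δ * l1 q.1 + -δ * l1 q.2 by ring, Real.exp_add] at h1
  exact h1

omit [Fintype Φ] in
/-- **PER-LEG ANNIHILATION ⟹ ZERO TOTAL MASS**: if `Σ'_u V₀ u y g f = 0` for every `y`, then `Σ'_{(u,y)} V₀ u y g f = 0`. [folklore] -/
theorem tsum_vertex_eq_zero_of_fibre (hδ : 0 < δ) (hV₀ : BiLoc V₀ 0 0 C₀ δ) (g f : Φ) (h0 : ∀ y : Pt, ∑' u : Pt, V₀ u y g f = 0) :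
    ∑' p : Pt × Pt, V₀ p.1 p.2 g f = 0 := by
  have hw := summable_weight hδ (loc_vertex₀ hV₀ g f)
  have hu : Summable (Function.uncurry fun u y : Pt => V₀ u y g f) := hw.congr fun _ => rfl
  calc ∑' p : Pt × Pt, V₀ p.1 p.2 g f = ∑' u : Pt, ∑' y : Pt, V₀ u y g f := hw.tsum_prod
    _ = ∑' y : Pt, ∑' u : Pt, V₀ u y g f := (hu.tsum_comm).symm
    _ = 0 := by simp [h0]

omit [Fintype Φ] in
/-- **PER-LEG ANNIHILATION ⟹ ZERO TOTAL MASS** for the vertex at `z` in the recentred currency: if `Σ'_w V₁ w x h a = 0` for every `x`, then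
`Σ'_{q} V₁ (z+q.2) (z+q.1) h a = 0`. [folklore] -/
theorem tsum_vertex₁_eq_zero_of_fibre (hδ : 0 < δ) (hV₁ : BiLoc V₁ z z C₁ δ) (h a : Φ) (h0 : ∀ x : Pt, ∑' w : Pt, V₁ w x h a = 0) :
    ∑' q : Pt × Pt, V₁ (z + q.2) (z + q.1) h a = 0 := by
  have hw := summable_weight hδ (loc_vertex₁ hV₁ h a)
  rw [hw.tsum_prod]
  have e : ∀ x' : Pt, ∑' w' : Pt, V₁ (z + w') (z + x') h a = 0 := fun x' => by
    rw [show (∑' w' : Pt, V₁ (z + w') (z + x') h a) = ∑' w : Pt, V₁ w (z + x') h a from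
      (Equiv.addLeft z).tsum_eq (fun w => V₁ w (z + x') h a)]
    exact h0 (z + x')
  simp [e]

end Letters

/-! ## §2 Summabilities -/

section Sums

variable {A V₀ V₁ : MKer 4 Φ} {CA C₀ C₁ δ : ℝ} {z : Pt}

/-- [folklore] `u ↦ e^{−δ|u|₁}` is summable on `ℤ⁴`. -/
theorem summable_exp (hδ : 0 < δ) : Summable fun u : Pt => Real.exp (-δ * l1 u) := by
  have h := (summable_expWeight_pow (D := 4) hδ 0).1
  simpa using h

/-- [folklore] The `u`-family of `comp A V₀` at `(x, y)` is absolutely summable: `Σ_g A x u a g·V₀ u y g f`. -/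
theorem summable_leg₀ (hδ : 0 < δ) (hA : ∀ x y a b, |A x y a b| ≤ CA) (hV₀ : BiLoc V₀ 0 0 C₀ δ) (x y : Pt) (a f : Φ) :
    Summable fun u : Pt => ‖∑ g, A x u a g * V₀ u y g f‖ := by
  have hCA : 0 ≤ CA := (abs_nonneg _).trans (hA 0 0 a a)
  refine Summable.of_nonneg_of_le (fun _ => norm_nonneg _) (fun u => ?_)
    (((summable_exp hδ).mul_left ((Fintype.card Φ : ℝ) * (CA * C₀) * Real.exp (-δ * l1 y))))
  rw [Real.norm_eq_abs]
  refine (Finset.abs_sum_le_sum_abs _ _).trans ?_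
  have hg : ∀ g ∈ (Finset.univ : Finset Φ), |A x u a g * V₀ u y g f| ≤ (CA * C₀) * Real.exp (-δ * l1 y) * Real.exp (-δ * l1 u) := by
    intro g _
    rw [abs_mul]
    have h1 := hA x u a g
    have h2 := loc_vertex₀ hV₀ g f (u, y)
    calc |A x u a g| * |V₀ u y g f| ≤ CA * (C₀ * (Real.exp (-δ * l1 u) * Real.exp (-δ * l1 y))) := mul_le_mul h1 h2 (abs_nonneg _) hCA
      _ = _ := by ring
  calc _ ≤ ∑ _g : Φ, (CA * C₀) * Real.exp (-δ * l1 y) * Real.exp (-δ * l1 u) := Finset.sum_le_sum hg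
    _ = _ := by rw [Finset.sum_const, Finset.card_univ, nsmul_eq_mul]; ring

/-- [folklore] The `w`-family of `comp A V₁` at `(y, x)` is absolutely summable: `Σ_h A y w f h·V₁ w x h a`. -/
theorem summable_leg₁ (hδ : 0 < δ) (hA : ∀ x y a b, |A x y a b| ≤ CA) (hV₁ : BiLoc V₁ z z C₁ δ) (y x : Pt) (f a : Φ) :
    Summable fun w : Pt => ‖∑ h, A y w f h * V₁ w x h a‖ := by
  have hCA : 0 ≤ CA := (abs_nonneg _).trans (hA 0 0 a a)
  refine Summable.of_nonneg_of_le (fun _ => norm_nonneg _) (fun w => ?_)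
    (((summable_exp_shift' (D := 4) (c := δ) hδ z)).mul_left ((Fintype.card Φ : ℝ) * (CA * C₁) * Real.exp (-δ * l1 (x - z))))
  rw [Real.norm_eq_abs]
  refine (Finset.abs_sum_le_sum_abs _ _).trans ?_
  have hg : ∀ h ∈ (Finset.univ : Finset Φ), |A y w f h * V₁ w x h a| ≤ (CA * C₁) * Real.exp (-δ * l1 (x - z)) * Real.exp (-δ * l1 (w - z)) := by
    intro h _
    rw [abs_mul]
    have h1 := hA y w f h
    have h2 := hV₁ w x h a
    rw [show -δ * (l1 (w - z) + l1 (x - z)) = -δ * l1 (w - z) + -δ * l1 (x - z) by ring, Real.exp_add] at h2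
    calc |A y w f h| * |V₁ w x h a| ≤ CA * (C₁ * (Real.exp (-δ * l1 (w - z)) * Real.exp (-δ * l1 (x - z)))) := mul_le_mul h1 h2 (abs_nonneg _) hCA
      _ = _ := by ring
  calc _ ≤ ∑ _h : Φ, (CA * C₁) * Real.exp (-δ * l1 (x - z)) * Real.exp (-δ * l1 (w - z)) := Finset.sum_le_sum hg
    _ = _ := by rw [Finset.sum_const, Finset.card_univ, nsmul_eq_mul]; ring

omit [Fintype Φ] in
/-- **THE FLAT FOUR-LEG FAMILY IS SUMMABLE** (indexed by `(x, (y, (u, w)))`, every fibre tuple). [folklore] -/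
theorem summable_flat (hδ : 0 < δ) (hA : ∀ x y a b, |A x y a b| ≤ CA) (hV₀ : BiLoc V₀ 0 0 C₀ δ) (hV₁ : BiLoc V₁ z z C₁ δ) (a f g h : Φ) :
    Summable fun X : Pt × (Pt × (Pt × Pt)) => A X.1 X.2.2.1 a g * V₀ X.2.2.1 X.2.1 g f * A X.2.1 X.2.2.2 f h * V₁ X.2.2.2 X.1 h a := by
  have hCA : 0 ≤ CA := (abs_nonneg _).trans (hA 0 0 a a)
  -- majorant: CA² · |V₀ u y| · |V₁ w x|
  have h0 : Summable fun p : Pt × Pt => |V₀ p.1 p.2 g f| := (summable_weight hδ (loc_vertex₀ hV₀ g f)).abs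
  have h1 : Summable fun q : Pt × Pt => |V₁ q.1 q.2 h a| := by
    have hloc : ∀ q : Pt × Pt, |V₁ q.1 q.2 h a| ≤ C₁ * (Real.exp (-δ * l1 (q.1 - z)) * Real.exp (-δ * l1 (q.2 - z))) := fun q => by
      have := hV₁ q.1 q.2 h a
      rwa [show -δ * (l1 (q.1 - z) + l1 (q.2 - z)) = -δ * l1 (q.1 - z) + -δ * l1 (q.2 - z) by ring, Real.exp_add] at this
    have hC₁ : 0 ≤ C₁ := by
      have := hloc (z, z); simp only [sub_self] at this
      have e : l1 (0 : Pt) = 0 := by unfold l1; simp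
      rw [e, mul_zero, Real.exp_zero, mul_one, mul_one] at this
      exact (abs_nonneg _).trans this
    refine Summable.of_nonneg_of_le (fun _ => abs_nonneg _) hloc ?_
    exact ((summable_exp_shift' (D := 4) (c := δ) hδ z).mul_of_nonneg (summable_exp_shift' (D := 4) (c := δ) hδ z)
      (fun _ => (Real.exp_pos _).le) (fun _ => (Real.exp_pos _).le)).mul_left C₁
  have hprod := (h0.mul_of_nonneg h1 (fun _ => abs_nonneg _) (fun _ => abs_nonneg _)).mul_left (CA * CA)
  -- reindex the majorant to `(x, (y, (u, w)))`: `((u, y), (w, x))`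
  let e : Pt × (Pt × (Pt × Pt)) ≃ (Pt × Pt) × (Pt × Pt) :=
    { toFun := fun X => ((X.2.2.1, X.2.1), (X.2.2.2, X.1))
      invFun := fun P => (P.2.2, (P.1.2, (P.1.1, P.2.1)))
      left_inv := fun _ => rfl
      right_inv := fun _ => rfl }
  have hmaj : Summable fun X : Pt × (Pt × (Pt × Pt)) => CA * CA * (|V₀ X.2.2.1 X.2.1 g f| * |V₁ X.2.2.2 X.1 h a|) :=
    (e.summable_iff.mpr hprod)
  refine Summable.of_norm_bounded hmaj (fun X => ?_)
  rw [Real.norm_eq_abs, abs_mul, abs_mul, abs_mul]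
  have e1 := hA X.1 X.2.2.1 a g
  have e2 := hA X.2.1 X.2.2.2 f h
  calc |A X.1 X.2.2.1 a g| * |V₀ X.2.2.1 X.2.1 g f| * |A X.2.1 X.2.2.2 f h| * |V₁ X.2.2.2 X.1 h a|
      ≤ CA * |V₀ X.2.2.1 X.2.1 g f| * CA * |V₁ X.2.2.2 X.1 h a| := by gcongr
    _ = CA * CA * (|V₀ X.2.2.1 X.2.1 g f| * |V₁ X.2.2.2 X.1 h a|) := by ring

/-- [folklore] The `u`-family's absolute sum: `Σ'_u |Σ_g A x u a g·V₀ u y g f| ≤ |Φ|·CA·C₀·e^{−δ|y|₁}·Zl 4 δ`. -/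
theorem tsum_norm_leg₀_le (hδ : 0 < δ) (hA : ∀ x y a b, |A x y a b| ≤ CA) (hV₀ : BiLoc V₀ 0 0 C₀ δ) (x y : Pt) (a f : Φ) :
    ∑' u : Pt, ‖∑ g, A x u a g * V₀ u y g f‖ ≤ (Fintype.card Φ : ℝ) * (CA * C₀) * Real.exp (-δ * l1 y) * Zl 4 δ := by
  have hCA : 0 ≤ CA := (abs_nonneg _).trans (hA 0 0 a a)
  have H : HasSum (fun u : Pt => (Fintype.card Φ : ℝ) * (CA * C₀) * Real.exp (-δ * l1 y) * Real.exp (-δ * l1 u))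
      ((Fintype.card Φ : ℝ) * (CA * C₀) * Real.exp (-δ * l1 y) * Zl 4 δ) := by
    have h := (summable_exp hδ).hasSum
    have e : ∑' u : Pt, Real.exp (-δ * l1 u) = Zl 4 δ := rfl
    rw [e] at h
    exact h.mul_left _
  refine (Summable.tsum_le_tsum (fun u => ?_) (summable_leg₀ hδ hA hV₀ x y a f) H.summable).trans (le_of_eq H.tsum_eq)
  rw [Real.norm_eq_abs]
  refine (Finset.abs_sum_le_sum_abs _ _).trans ?_
  have hg : ∀ g ∈ (Finset.univ : Finset Φ), |A x u a g * V₀ u y g f| ≤ (CA * C₀) * Real.exp (-δ * l1 y) * Real.exp (-δ * l1 u) := by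
    intro g _
    rw [abs_mul]
    have h1 := hA x u a g
    have h2 := loc_vertex₀ hV₀ g f (u, y)
    calc |A x u a g| * |V₀ u y g f| ≤ CA * (C₀ * (Real.exp (-δ * l1 u) * Real.exp (-δ * l1 y))) := mul_le_mul h1 h2 (abs_nonneg _) hCA
      _ = _ := by ring
  calc _ ≤ ∑ _g : Φ, (CA * C₀) * Real.exp (-δ * l1 y) * Real.exp (-δ * l1 u) := Finset.sum_le_sum hg
    _ = _ := by rw [Finset.sum_const, Finset.card_univ, nsmul_eq_mul]; ring

/-- [folklore] The `w`-family's absolute sum: `Σ'_w |Σ_h A y w f h·V₁ w x h a| ≤ |Φ|·CA·C₁·e^{−δ|x−z|₁}·Zl 4 δ`. -/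
theorem tsum_norm_leg₁_le (hδ : 0 < δ) (hA : ∀ x y a b, |A x y a b| ≤ CA) (hV₁ : BiLoc V₁ z z C₁ δ) (y x : Pt) (f a : Φ) :
    ∑' w : Pt, ‖∑ h, A y w f h * V₁ w x h a‖ ≤ (Fintype.card Φ : ℝ) * (CA * C₁) * Real.exp (-δ * l1 (x - z)) * Zl 4 δ := by
  have hCA : 0 ≤ CA := (abs_nonneg _).trans (hA 0 0 a a)
  have H : HasSum (fun w : Pt => (Fintype.card Φ : ℝ) * (CA * C₁) * Real.exp (-δ * l1 (x - z)) * Real.exp (-δ * l1 (w - z)))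
      ((Fintype.card Φ : ℝ) * (CA * C₁) * Real.exp (-δ * l1 (x - z)) * Zl 4 δ) := by
    have h := (summable_exp_shift' (D := 4) (c := δ) hδ z).hasSum
    rw [ExpKernelCalculus.tsum_exp_shift'] at h
    exact h.mul_left _
  refine (Summable.tsum_le_tsum (fun w => ?_) (summable_leg₁ hδ hA hV₁ y x f a) H.summable).trans (le_of_eq H.tsum_eq)
  rw [Real.norm_eq_abs]
  refine (Finset.abs_sum_le_sum_abs _ _).trans ?_
  have hg : ∀ h ∈ (Finset.univ : Finset Φ), |A y w f h * V₁ w x h a| ≤ (CA * C₁) * Real.exp (-δ * l1 (x - z)) * Real.exp (-δ * l1 (w - z)) := by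
    intro h _
    rw [abs_mul]
    have h1 := hA y w f h
    have h2 := hV₁ w x h a
    rw [show -δ * (l1 (w - z) + l1 (x - z)) = -δ * l1 (w - z) + -δ * l1 (x - z) by ring, Real.exp_add] at h2
    calc |A y w f h| * |V₁ w x h a| ≤ CA * (C₁ * (Real.exp (-δ * l1 (w - z)) * Real.exp (-δ * l1 (x - z)))) := mul_le_mul h1 h2 (abs_nonneg _) hCA
      _ = _ := by ring
  calc _ ≤ ∑ _h : Φ, (CA * C₁) * Real.exp (-δ * l1 (x - z)) * Real.exp (-δ * l1 (w - z)) := Finset.sum_le_sum hg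
    _ = _ := by rw [Finset.sum_const, Finset.card_univ, nsmul_eq_mul]; ring

end Sums

/-! ## §3 The bubble as a finite sum of flat double smears -/

section Main

variable {A V₀ V₁ : MKer 4 Φ} {CA C₀ C₁ δ : ℝ} {z : Pt}

/-- **THE BUBBLE IS A FINITE SUM OF FLAT FOUR-LEG SUMS**: for a bounded leg kernel `A` and vertices `V₀` bi-localised at `(0,0)`, `V₁` at `(z,z)`,
`bubble A V₀ V₁ = Σ_{a f g h} Σ'_{P : (Pt×Pt)×(Pt×Pt)} V₀ P.1.1 P.1.2 g f · V₁ (z+P.2.2) (z+P.2.1) h a · A (z+P.2.1) P.1.1 a g · A P.1.2 (z+P.2.2) f h`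
(`P.1 = (u, y)` the legs of `V₀`, `P.2 = (x′, w′)` the legs of `V₁` recentred at `z`; absolutely convergent rearrangement of `tr ((A∘V₀)∘(A∘V₁))`). [folklore] -/
theorem bubble_eq_sum_tsum (hδ : 0 < δ) (hA : ∀ x y a b, |A x y a b| ≤ CA) (hV₀ : BiLoc V₀ 0 0 C₀ δ) (hV₁ : BiLoc V₁ z z C₁ δ) :
    bubble A V₀ V₁ = ∑ a, ∑ f, ∑ g, ∑ h, ∑' P : (Pt × Pt) × (Pt × Pt),
      V₀ P.1.1 P.1.2 g f * V₁ (z + P.2.2) (z + P.2.1) h a * A (z + P.2.1) P.1.1 a g * A P.1.2 (z + P.2.2) f h := by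
  classical
  -- (0) unfold the nested definition
  have e0 : bubble A V₀ V₁ = ∑' x : Pt, ∑ a, ∑' y : Pt, ∑ f, (∑' u : Pt, ∑ g, A x u a g * V₀ u y g f) * (∑' w : Pt, ∑ h, A y w f h * V₁ w x h a) := rfl
  -- the flat family
  set T : Φ → Φ → Φ → Φ → Pt × (Pt × (Pt × Pt)) → ℝ :=
    fun a f g h X => A X.1 X.2.2.1 a g * V₀ X.2.2.1 X.2.1 g f * A X.2.1 X.2.2.2 f h * V₁ X.2.2.2 X.1 h a with hT
  have hTs : ∀ a f g h, Summable (T a f g h) := fun a f g h => summable_flat hδ hA hV₀ hV₁ a f g h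
  -- (1) the inner product of the two leg sums is a tsum over `(u, w)` of `Σ_g Σ_h T`
  have step1 : ∀ (x y : Pt) (a f : Φ), (∑' u : Pt, ∑ g, A x u a g * V₀ u y g f) * (∑' w : Pt, ∑ h, A y w f h * V₁ w x h a)
      = ∑' uw : Pt × Pt, ∑ g, ∑ h, T a f g h (x, (y, uw)) := by
    intro x y a f
    rw [tsum_mul_tsum_of_summable_norm (summable_leg₀ hδ hA hV₀ x y a f) (summable_leg₁ hδ hA hV₁ y x f a)]
    refine tsum_congr fun uw => ?_
    rw [Finset.sum_mul_sum]
    refine Finset.sum_congr rfl fun g _ => Finset.sum_congr rfl fun h _ => ?_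
    simp only [hT]; ring
  -- summability of `uw ↦ Σ_g Σ_h T` and the bound on its sum
  have hGs : ∀ (x y : Pt) (a f : Φ), Summable fun uw : Pt × Pt => ∑ g, ∑ h, T a f g h (x, (y, uw)) := by
    intro x y a f
    have h := summable_mul_of_summable_norm (summable_leg₀ hδ hA hV₀ x y a f) (summable_leg₁ hδ hA hV₁ y x f a)
    refine h.congr fun uw => ?_
    rw [Finset.sum_mul_sum]
    refine Finset.sum_congr rfl fun g _ => Finset.sum_congr rfl fun h _ => ?_
    simp only [hT]; ring
  have hHb : ∀ (x y : Pt) (a f : Φ), |∑' uw : Pt × Pt, ∑ g, ∑ h, T a f g h (x, (y, uw))|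
      ≤ ((Fintype.card Φ : ℝ) * (CA * C₀) * Real.exp (-δ * l1 y) * Zl 4 δ) * ((Fintype.card Φ : ℝ) * (CA * C₁) * Real.exp (-δ * l1 (x - z)) * Zl 4 δ) := by
    intro x y a f
    rw [← step1, abs_mul]
    have h0 := norm_tsum_le_tsum_norm (summable_leg₀ hδ hA hV₀ x y a f)
    have h1 := norm_tsum_le_tsum_norm (summable_leg₁ hδ hA hV₁ y x f a)
    rw [Real.norm_eq_abs] at h0 h1
    exact mul_le_mul (h0.trans (tsum_norm_leg₀_le hδ hA hV₀ x y a f)) (h1.trans (tsum_norm_leg₁_le hδ hA hV₁ y x f a))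
      (abs_nonneg _) ((abs_nonneg _).trans (h0.trans (tsum_norm_leg₀_le hδ hA hV₀ x y a f)))
  -- summability in `y` of `Σ_f Σ'_{uw} Σ_g Σ_h T`
  have hYs : ∀ (x : Pt) (a : Φ), Summable fun y : Pt => ∑ f, ∑' uw : Pt × Pt, ∑ g, ∑ h, T a f g h (x, (y, uw)) := by
    intro x a
    refine summable_sum fun f _ => ?_
    refine Summable.of_norm_bounded (((summable_exp hδ).mul_left (((Fintype.card Φ : ℝ) * (CA * C₀) * Zl 4 δ)
      * ((Fintype.card Φ : ℝ) * (CA * C₁) * Real.exp (-δ * l1 (x - z)) * Zl 4 δ)))) (fun y => ?_)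
    rw [Real.norm_eq_abs]
    refine (hHb x y a f).trans (le_of_eq ?_)
    ring
  -- (2) the nested form equals the tsum of the total flat family `S`
  set S : Pt × (Pt × (Pt × Pt)) → ℝ := fun X => ∑ a, ∑ f, ∑ g, ∑ h, T a f g h X with hS
  have hSs : Summable S := summable_sum fun a _ => summable_sum fun f _ => summable_sum fun g _ => summable_sum fun h _ => hTs a f g h
  have step2 : bubble A V₀ V₁ = ∑' X, S X := by
    rw [e0, hSs.tsum_prod]
    refine tsum_congr fun x => ?_
    rw [(hSs.prod_factor x).tsum_prod]
    have e1 : ∀ y : Pt, ∑' uw : Pt × Pt, S (x, (y, uw)) = ∑ a, ∑ f, ∑' uw : Pt × Pt, ∑ g, ∑ h, T a f g h (x, (y, uw)) := by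
      intro y
      simp only [hS]
      rw [Summable.tsum_finsetSum (fun a _ => summable_sum fun f _ => hGs x y a f)]
      refine Finset.sum_congr rfl fun a _ => ?_
      rw [Summable.tsum_finsetSum (fun f _ => hGs x y a f)]
    simp only [e1]
    have e2 : ∑' y : Pt, ∑ a, ∑ f, ∑' uw : Pt × Pt, ∑ g, ∑ h, T a f g h (x, (y, uw))
        = ∑ a, ∑' y : Pt, ∑ f, ∑' uw : Pt × Pt, ∑ g, ∑ h, T a f g h (x, (y, uw)) :=
      Summable.tsum_finsetSum (fun a _ => hYs x a)
    rw [e2]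
    exact Finset.sum_congr rfl fun a _ => tsum_congr fun y => Finset.sum_congr rfl fun f _ => step1 x y a f
  -- (3) finite sums out, and the recentring equivalence `P ↦ (z + P.2.1, (P.1.2, (P.1.1, z + P.2.2)))`
  rw [step2]
  simp only [hS]
  rw [Summable.tsum_finsetSum (fun a _ => summable_sum fun f _ => summable_sum fun g _ => summable_sum fun h _ => hTs a f g h)]
  refine Finset.sum_congr rfl fun a _ => ?_
  rw [Summable.tsum_finsetSum (fun f _ => summable_sum fun g _ => summable_sum fun h _ => hTs a f g h)]
  refine Finset.sum_congr rfl fun f _ => ?_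
  rw [Summable.tsum_finsetSum (fun g _ => summable_sum fun h _ => hTs a f g h)]
  refine Finset.sum_congr rfl fun g _ => ?_
  rw [Summable.tsum_finsetSum (fun h _ => hTs a f g h)]
  refine Finset.sum_congr rfl fun h _ => ?_
  let e : (Pt × Pt) × (Pt × Pt) ≃ Pt × (Pt × (Pt × Pt)) :=
    { toFun := fun P => (z + P.2.1, (P.1.2, (P.1.1, z + P.2.2)))
      invFun := fun X => ((X.2.2.1, X.2.1), (X.1 - z, X.2.2.2 - z))
      left_inv := fun P => by
        obtain ⟨⟨u, y⟩, ⟨x', w'⟩⟩ := P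
        simp
      right_inv := fun X => by
        obtain ⟨x, y, u, w⟩ := X
        simp }
  rw [← e.tsum_eq]
  exact tsum_congr fun P => by simp only [hT, e, Equiv.coe_fn_mk]; ring

/-- **THE BUBBLE IS A FINITE SUM OF DOUBLE SMEARS** (translation-invariant leg): if moreover `shiftK v A = A` for all `v`, then
`bubble A V₀ V₁ = Σ_{a f g h} Σ'_{P} (V₀ P.1.1 P.1.2 g f) · (V₁ (z+P.2.2) (z+P.2.1) h a) · A 0 (−(z + P.2.1 − P.1.1)) a g · A 0 (z + P.2.2 − P.1.2) f h` — LITERALLY the object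
`B z` of `FP/ExpLocalisedBubbleMixed` with `c₀ p := V₀ p.1 p.2 g f`, `c₁ q := V₁ (z+q.2) (z+q.1) h a`, `F v := A 0 (−v) a g`, `G v := A 0 v f h`. [folklore] -/
theorem bubble_eq_sum_smear (hδ : 0 < δ) (hA : ∀ x y a b, |A x y a b| ≤ CA) (hT : ∀ v : Pt, shiftK v A = A)
    (hV₀ : BiLoc V₀ 0 0 C₀ δ) (hV₁ : BiLoc V₁ z z C₁ δ) :
    bubble A V₀ V₁ = ∑ a, ∑ f, ∑ g, ∑ h, ∑' P : (Pt × Pt) × (Pt × Pt),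
      (V₀ P.1.1 P.1.2 g f) * (V₁ (z + P.2.2) (z + P.2.1) h a) * A 0 (-(z + P.2.1 - P.1.1)) a g * A 0 (z + P.2.2 - P.1.2) f h := by
  rw [bubble_eq_sum_tsum hδ hA hV₀ hV₁]
  refine Finset.sum_congr rfl fun a _ => Finset.sum_congr rfl fun f _ => Finset.sum_congr rfl fun g _ => Finset.sum_congr rfl fun h _ =>
    tsum_congr fun P => ?_
  rw [transl_apply hT (z + P.2.1) P.1.1 a g, transl_apply hT P.1.2 (z + P.2.2) f h, neg_sub]

end Main

end Summit.QuantumFields.BalabanUV.Beta.FP.BubbleSmearBridge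

end
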